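import Summits.HodgeConjecture.HodgeConjecture.Theorems.NikulinTwinTransportAlgebraicClassesOneOneK3Proof
import Literature.AlgebraicGeometry.HodgeTheory.HodgeIndexSurface
import Literature.AlgebraicGeometry.HodgeTheory.SupportedClassesRationalProofs
import Literature.AlgebraicTopology.SingularHomology.CupProductProofs

/-!
# Crux `TwinTransportRMPicardTwo` (stmt-HodgeConjecture-15067), line `Sketch` — the Hodge index
# hypothesis is FREE at Picard rank two in the presence of the `e`-block

Helper file (`--supports stmt-HodgeConjecture-15067`) for the line `Sketch` (dihedral Hecke octagon)
of the crux `Summit.HodgeConjecture.HodgeConjecture.Theses.NikulinTwinTransport.TwinTransportRMPicardTwo`.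

The skeleton `Cruxes/TwinTransportRMPicardTwo/Lines/Sketch.lean` consumed the named fact
`hodgeIndex_surface S` (Hartshorne V Thm. 1.9, sign-free homological form) through its stub
`stub_k3Facts`. This file shows that, under the HYPOTHESES OF THE CRUX ITSELF — Picard rank two,
`finrank_ℂ N = 2` for `N := algebraicClasses S 1 = N¹H²(S(ℂ); ℂ)`, and an endomorphism `e` of
`H²(S(ℂ); ℂ)` with `e|N = 0` and `e (e x) = 2x` for `x ⊥ N` — the statement `hodgeIndex_surface S`
is a THEOREM, for every smooth projective complex surface `S` (no K3 hypothesis, no marking, no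
coniveau fact):

* `algebraicClasses_eq_zero_of_orthogonal_of_eBlock` — `N ∩ N^⊥ = 0`: for `d ∈ N` orthogonal to `N`,
  `2d = e (e d) = e 0 = 0`.
* `exists_isRationalClass_cup_self_ne_zero_of_eBlock` — if `N ≠ 0` there is a RATIONAL `h ∈ N` with
  `h ∪ h ≠ 0`: `N` is the `ℂ`-span of its rational classes (`supportedClasses_eq_span_isRationalClass`,
  proved), and if every rational class of `N` were isotropic then, by polarisation (the cup product
  is commutative in degree `2`, `cupProduct_gradedComm_holds`), the cup form would vanish identically
  on `N`, i.e. `N ⊆ N ∩ N^⊥ = 0`.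
* `hodgeIndex_surface_of_rankTwo_eBlock` — `hodgeIndex_surface S`: take that `h` (rational, in `N`,
  of type `(1,1)` by the proved `isOfHodgeType_oneOne_of_mem_algebraicClasses_surface`, `h ∪ h ≠ 0`);
  a rational `c ∈ N` with `c ∪ h = 0`, `c ≠ 0`, `c ∪ c = 0` would be independent from `h`, so
  `N = ℂh ⊕ ℂc` (rank two) and `c ⊥ N`, contradicting `N ∩ N^⊥ = 0`.

`stub_hodgeIndex_of_eBlock` is the registered stub of the skeleton, verbatim.

So the line's composition needs only the two named facts `Huybrechts_K3_marking_exists` and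
`Grothendieck1969_supportedClasses_le_hodgeConiveau` besides its geometric heart (reshaped stub
`stub_k3Facts` of the skeleton). Lead seat prover-line-stmt-HodgeConjecture-15067-c1-0.

## References

* [Hartshorne1977] R. Hartshorne, *Algebraic Geometry*, Springer 1977, V Thm. 1.9, Rem. 1.9.1.
* [Huybrechts2016K3] D. Huybrechts, *Lectures on K3 Surfaces*, CUP 2016, Ch. 1 Prop. 2.4, Ch. 3 §2.2.
-/

noncomputable section

set_option linter.dupNamespace false

namespace Summit.HodgeConjecture.HodgeConjecture.Theorems.NikulinTwinTransport

open CategoryTheory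
open Literature.AlgebraicGeometry.Motives Literature.AlgebraicGeometry.HodgeTheory
open Literature.AlgebraicTopology.SingularHomology

variable {S : SchemeOver ℂ}

/-- **`N ∩ N^⊥ = 0` from the `e`-block.** If `e` kills `N = algebraicClasses S 1` and
`e (e x) = 2x` for every `x` orthogonal to `N`, then an algebraic class orthogonal to all algebraic
classes vanishes: `2d = e (e d) = e 0 = 0`. No hypothesis on `S`. [folklore] -/
theorem algebraicClasses_eq_zero_of_orthogonal_of_eBlock
    (e : complexBetti S (2 * 1) →ₗ[ℂ] complexBetti S (2 * 1))
    (he_N : ∀ d ∈ algebraicClasses S 1, e d = 0)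
    (he_T : ∀ x : complexBetti S (2 * 1),
      (∀ d ∈ algebraicClasses S 1, cupProduct (rfl : 2 * 1 + 2 * 1 = 2 * 2) x d = 0) →
        e (e x) = (2 : ℂ) • x)
    {d : complexBetti S (2 * 1)} (hdN : d ∈ algebraicClasses S 1)
    (hdT : ∀ d' ∈ algebraicClasses S 1, cupProduct (rfl : 2 * 1 + 2 * 1 = 2 * 2) d d' = 0) :
    d = 0 := by
  have h2 : (2 : ℂ) • d = 0 := by
    rw [← he_T d hdT, he_N d hdN, map_zero]
  exact (smul_eq_zero.mp h2).resolve_left two_ne_zero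

/-- The cup product of degree-`2` classes on `S(ℂ)` is commutative (graded commutativity in even
degree). [cite: Hatcher2002, Thm. 3.11] -/
theorem cupProduct_comm_of_degree_two (a b : complexBetti S (2 * 1)) :
    cupProduct (rfl : 2 * 1 + 2 * 1 = 2 * 2) a b = cupProduct (rfl : 2 * 1 + 2 * 1 = 2 * 2) b a := by
  rw [cupProduct_gradedComm_holds ℂ _ (rfl : 2 * 1 + 2 * 1 = 2 * 2) rfl]
  norm_num

/-- **A rational algebraic class of non-zero square exists** on a smooth projective complex surface
with `N = algebraicClasses S 1 ≠ 0` carrying the `e`-block (`e|N = 0`, `e² = 2` on `N^⊥`): `N` is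
the `ℂ`-span of its rational classes, and if all of these were isotropic the cup form would vanish
on `N × N` by polarisation, forcing `N ⊆ N ∩ N^⊥ = 0`. [cite: Huybrechts2016K3, Ch. 3 §2.2] -/
theorem exists_isRationalClass_cup_self_ne_zero_of_eBlock (hS : IsSmoothProjective 2 S)
    (hN : algebraicClasses S 1 ≠ ⊥)
    (e : complexBetti S (2 * 1) →ₗ[ℂ] complexBetti S (2 * 1))
    (he_N : ∀ d ∈ algebraicClasses S 1, e d = 0)
    (he_T : ∀ x : complexBetti S (2 * 1),
      (∀ d ∈ algebraicClasses S 1, cupProduct (rfl : 2 * 1 + 2 * 1 = 2 * 2) x d = 0) →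
        e (e x) = (2 : ℂ) • x) :
    ∃ h : complexBetti S (2 * 1), IsRationalClass h ∧ h ∈ algebraicClasses S 1 ∧
      cupProduct (rfl : 2 * 1 + 2 * 1 = 2 * 2) h h ≠ 0 := by
  by_contra hcon
  push Not at hcon
  -- every pair of rational algebraic classes is orthogonal (polarisation)
  have hpair : ∀ c c' : complexBetti S (2 * 1), IsRationalClass c → c ∈ algebraicClasses S 1 →
      IsRationalClass c' → c' ∈ algebraicClasses S 1 →
        cupProduct (rfl : 2 * 1 + 2 * 1 = 2 * 2) c c' = 0 := by
    intro c c' hc hcN hc' hc'N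
    have hsum := hcon (c + c') (hc.add hc') (Submodule.add_mem _ hcN hc'N)
    simp only [map_add, LinearMap.add_apply, hcon c hc hcN, hcon c' hc' hc'N, zero_add,
      add_zero] at hsum
    rw [cupProduct_comm_of_degree_two c' c] at hsum
    have h2 : (2 : ℂ) • cupProduct (rfl : 2 * 1 + 2 * 1 = 2 * 2) c c' = 0 := by
      rw [two_smul]; exact hsum
    exact (smul_eq_zero.mp h2).resolve_left two_ne_zero
  -- hence the cup form vanishes on `N × N` (`N` is spanned by its rational classes)
  have hspan := supportedClasses_eq_span_isRationalClass hS (2 * 1) 1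
  have hall : ∀ x ∈ algebraicClasses S 1, ∀ d ∈ algebraicClasses S 1,
      cupProduct (rfl : 2 * 1 + 2 * 1 = 2 * 2) x d = 0 := by
    intro x hx d hd
    have hx' : x ∈ Submodule.span ℂ {c : complexBetti S (2 * 1) |
        IsRationalClass c ∧ c ∈ supportedClasses S (2 * 1) 1} := by rw [← hspan]; exact hx
    have hd' : d ∈ Submodule.span ℂ {c : complexBetti S (2 * 1) |
        IsRationalClass c ∧ c ∈ supportedClasses S (2 * 1) 1} := by rw [← hspan]; exact hd
    clear hx hd
    induction hd' using Submodule.span_induction with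
    | mem d hd =>
      induction hx' using Submodule.span_induction with
      | mem x hx => exact hpair x d hx.1 hx.2 hd.1 hd.2
      | zero => rw [map_zero, LinearMap.zero_apply]
      | add x x' _ _ hx hx' => rw [map_add, LinearMap.add_apply, hx, hx', add_zero]
      | smul t x _ hx => rw [map_smul, LinearMap.smul_apply, hx, smul_zero]
    | zero => rw [map_zero]
    | add d d' _ _ hd hd' => rw [map_add, hd, hd', add_zero]
    | smul t d _ hd => rw [map_smul, hd, smul_zero]
  -- so `N ⊆ N ∩ N^⊥ = 0`
  apply hN
  rw [eq_bot_iff]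
  intro d hd
  rw [Submodule.mem_bot]
  exact algebraicClasses_eq_zero_of_orthogonal_of_eBlock e he_N he_T hd (hall d hd)

/-- **The Hodge index hypothesis is free at Picard rank two with the `e`-block.** For a smooth
projective complex surface `S` with `finrank_ℂ (algebraicClasses S 1) = 2` and an endomorphism `e` of
`H²(S(ℂ); ℂ)` killing `N = algebraicClasses S 1` with `e (e x) = 2x` on `N^⊥`, the named statement
`hodgeIndex_surface S` HOLDS: the witness `h` is a rational algebraic class with `h ∪ h ≠ 0`
(`exists_isRationalClass_cup_self_ne_zero_of_eBlock`; of type `(1,1)` as every algebraic divisor class,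
`isOfHodgeType_oneOne_of_mem_algebraicClasses_surface`), and a rational algebraic `c ≠ 0` with
`c ∪ h = 0 = c ∪ c` would span `N` together with `h` and lie in `N ∩ N^⊥ = 0`.
[cite: Hartshorne1977, V Thm. 1.9 and Rem. 1.9.1] [cite: Huybrechts2016K3, Ch. 3 §2.2] -/
theorem hodgeIndex_surface_of_rankTwo_eBlock
    (hrank : Module.finrank ℂ ↥(algebraicClasses S 1) = 2)
    (e : complexBetti S (2 * 1) →ₗ[ℂ] complexBetti S (2 * 1))
    (he_N : ∀ d ∈ algebraicClasses S 1, e d = 0)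
    (he_T : ∀ x : complexBetti S (2 * 1),
      (∀ d ∈ algebraicClasses S 1, cupProduct (rfl : 2 * 1 + 2 * 1 = 2 * 2) x d = 0) →
        e (e x) = (2 : ℂ) • x) :
    hodgeIndex_surface S := by
  intro hS
  have hN : algebraicClasses S 1 ≠ ⊥ := by
    intro h
    rw [h, finrank_bot] at hrank
    exact two_ne_zero hrank.symm
  obtain ⟨h, hh, hhN, hhh⟩ := exists_isRationalClass_cup_self_ne_zero_of_eBlock hS hN e he_N he_T
  refine ⟨h, hh, Theorems.isOfHodgeType_oneOne_of_mem_algebraicClasses_surface hS hhN, hhN, hhh, ?_⟩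
  intro c hc hcN hch hc0 hcc
  -- `h` and `c` are linearly independent
  have hind : LinearIndependent ℂ ![h, c] := by
    rw [LinearIndependent.pair_iff]
    intro s t hst
    have h1 := congrArg (fun x => cupProduct (rfl : 2 * 1 + 2 * 1 = 2 * 2) x h) hst
    simp only [map_add, map_smul, LinearMap.add_apply, LinearMap.smul_apply, map_zero,
      LinearMap.zero_apply, hch, smul_zero, add_zero, smul_eq_zero] at h1
    have hs : s = 0 := h1.resolve_right hhh
    rw [hs, zero_smul, zero_add, smul_eq_zero] at hst
    exact ⟨hs, hst.resolve_right hc0⟩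
  -- hence they span `N`
  haveI : Module.Finite ℂ ↥(algebraicClasses S 1) :=
    Module.finite_of_finrank_pos (by rw [hrank]; exact two_pos)
  have hle : Submodule.span ℂ (Set.range ![h, c]) ≤ algebraicClasses S 1 := by
    rw [Submodule.span_le]
    rintro _ ⟨i, rfl⟩
    fin_cases i
    · exact hhN
    · exact hcN
  have heq : Submodule.span ℂ (Set.range ![h, c]) = algebraicClasses S 1 := by
    refine Submodule.eq_of_le_of_finrank_eq hle ?_
    rw [finrank_span_eq_card hind, hrank]
    simp
  -- so `c ⊥ N`, and `c ∈ N ∩ N^⊥ = 0`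
  have hcT : ∀ d ∈ algebraicClasses S 1, cupProduct (rfl : 2 * 1 + 2 * 1 = 2 * 2) c d = 0 := by
    intro d hd
    rw [← heq, Matrix.range_cons, Matrix.range_cons, Matrix.range_empty, Set.union_empty,
      Set.union_singleton, Submodule.mem_span_pair] at hd
    obtain ⟨a, b, rfl⟩ := hd
    rw [map_add, map_smul, map_smul, hch, cupProduct_comm_of_degree_two c c]
    change a • cupProduct (rfl : 2 * 1 + 2 * 1 = 2 * 2) c c + b • (0 : complexBetti S (2 * 2)) = 0
    rw [hcc, smul_zero, smul_zero, add_zero]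
  exact hc0 (algebraicClasses_eq_zero_of_orthogonal_of_eBlock e he_N he_T hcN hcT)

/-- **Registered stub `stub_hodgeIndex_of_eBlock` of the skeleton `Cruxes/TwinTransportRMPicardTwo/Lines/Sketch.lean`**
(line `Sketch`, lead c1): for every `ℂ`-scheme `S` with `finrank_ℂ (algebraicClasses S 1) = 2` and an
endomorphism `e` of `H²(S(ℂ); ℂ)` killing `algebraicClasses S 1` with `e (e x) = 2x` on its
orthogonal, `hodgeIndex_surface S` holds — `hodgeIndex_surface_of_rankTwo_eBlock` in the stub's
binder order. [cite: Hartshorne1977, V Thm. 1.9 and Rem. 1.9.1] -/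
theorem stub_hodgeIndex_of_eBlock : ∀ (S : SchemeOver ℂ),
    Module.finrank ℂ ↥(algebraicClasses S 1) = 2 →
    ∀ (e : complexBetti S (2 * 1) →ₗ[ℂ] complexBetti S (2 * 1)),
      (∀ d ∈ algebraicClasses S 1, e d = 0) →
      (∀ x : complexBetti S (2 * 1),
          (∀ d ∈ algebraicClasses S 1, cupProduct (rfl : 2 * 1 + 2 * 1 = 2 * 2) x d = 0) →
            e (e x) = (2 : ℂ) • x) →
      hodgeIndex_surface S :=
  fun _ hrank e he_N he_T => hodgeIndex_surface_of_rankTwo_eBlock hrank e he_N he_T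

end Summit.HodgeConjecture.HodgeConjecture.Theorems.NikulinTwinTransport

end
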